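import Summits.CriticalPhenomena.SAWScalingLimit.Theorems.IsingBoundaryRatio.Negative.IsingBoundaryRatioLattice
import Literature.Probability.RandomPlanarGeometry.SAWScalingLimitFamily
import Literature.Probability.LatticeModels.MeshDomainJordan
import Literature.Probability.LatticeModels.ModifiedSimonInequality

/-!
# `ArmOriginForgettingAt` (line `fk-anchor-transfer`, rev 4 of lead-1) is FALSE as defined —
kernel-checked witness (cycle-c1 lead `prover-line-stmt-CriticalPhenomena-10650-c1-0`)

The rev-4 skeleton `Cruxes/IsingBoundaryRatio/Lines/fk_anchor_transfer.lean` (lead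
`prover-line-stmt-CriticalPhenomena-10650-1`, skeleton `e54552262d37`) reshaped `stub_anchorLocality` through
the definitions `LocalAgreement`, `τ`, `ArmOriginForgettingAt` (copied VERBATIM below, in this file's own
namespace) and the stubs `stub_armOriginForgettingCore : ChartAnnulusSeparation → RoughHalfAnnulusRSW →
∀ D, ArmOriginForgettingAt D.carrier (D.pt 0)` (1c) and `stub_localAgreementTransfer :
ArmOriginForgetting → AnchorLocality` (1e).

`not_armOriginForgettingAt` below proves `¬ ArmOriginForgettingAt D.carrier p` for EVERY Jordan domain `D`
and every `p ∈ closure D` (in particular `p = D.pt 0` of a Dobrushin domain,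
`not_armOriginForgettingAt_pt`). Consequences: 1c asserts that one of its two intended-true hypotheses
is false (MISSTATED as registered), and 1e is vacuously true (a junk landing would prove nothing).

WITNESS (degenerate supergraph). The hypotheses of `ArmOriginForgettingAt` ask for `G.Reachable x y` in
the whole graph `G` on `Site 2`, while `τ G Λ x y = ⟨σ_xσ_y⟩^free_{(G,Λ)}` only sees the interaction edges
with both ends in `Λ`. Take `Λ := Ω_δ ∪ {y₁}` and `G := Ω_δ` plus the two edges `u₁q`, `qy₁`, where
`x = x'` is the rounded site of a point of `D` near `p`, `u₁` the rounded site of a point of `D` outside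
`B(p, ε)` (joined to `x` in `Ω_δ` for small `δ`, `JordanDomain.eventually_forall_mem_meshDomain'`), and
`q ≠ y₁` rounded sites of two points far outside `D`. Local agreement holds (the extra edges live outside
the ball), `x ⇝ u₁ → q → y₁` in `G`, but `y₁` is isolated in `edgesIn G Λ` (`q ∉ Λ`), so by the
high-temperature expansion `τ G Λ x y₁ = 0` and the double ratio is Lean's junk `0/0/(0/0) = 0`:
`|0 - 1| = 1 ≥ η`.

REPAIR (minimal): require reachability INSIDE the finite volume (`(G.induce ↑Λ).Reachable`, or the
`G.comap Subtype.val : SimpleGraph Λ` of `RoughHalfAnnulusRSW`), or add positivity of the three `τ`'s in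
the denominators.
-/

noncomputable section

open scoped Classical Topology symmDiff
open Filter Set Metric
open Literature.Probability.LatticeModels Literature.Probability.RandomPlanarGeometry

namespace Summit.CriticalPhenomena.SAWScalingLimit.Cruxes.IsingBoundaryRatio.FkAnchorTransferC1

/-! ### Verbatim copies of the rev-4 definitions (namespace `…FkAnchorTransfer` of the Lines file) -/

/-- (verbatim) Local agreement of `(G, Λ)` with `Ω_δ` inside `B(p, ε)`. -/
def LocalAgreement (Ω : Set ℂ) (p : ℂ) (ε δ : ℝ) (G : SimpleGraph (Site 2))
    (Λ : Finset (Site 2)) : Prop :=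
  ∀ w ∈ Λ, meshPoint δ w ∈ Metric.ball p ε →
    ∀ v : Site 2, (G.Adj w v ↔ (discreteDomainGraph Ω δ).Adj w v) ∧
      ((discreteDomainGraph Ω δ).Adj w v → v ∈ Λ)

/-- (verbatim) The free critical Ising two-point function of the finite volume `(G, Λ)`. -/
def τ (G : SimpleGraph (Site 2)) [G.LocallyFinite] (Λ : Finset (Site 2)) (x y : Site 2) : ℝ :=
  isingTwoPoint G Λ criticalBetaTwo 0 .free x y

/-- (verbatim) Arm-origin forgetting at a boundary point `p` of `Ω`, rev-4 form. -/
def ArmOriginForgettingAt (Ω : Set ℂ) (p : ℂ) : Prop :=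
  ∀ (ε c η : ℝ), 0 < ε → 0 < c → 0 < η → ∃ r : ℝ, 0 < r ∧ ∀ᶠ δ in 𝓝[>] (0 : ℝ),
    ∀ (G₁ : SimpleGraph (Site 2)) [G₁.LocallyFinite] (G₂ : SimpleGraph (Site 2)) [G₂.LocallyFinite]
      (Λ₁ Λ₂ : Finset (Site 2)) (x x' y₁ y₂ : Site 2),
      LocalAgreement Ω p ε δ G₁ Λ₁ → LocalAgreement Ω p ε δ G₂ Λ₂ →
      x ∈ Λ₁ → x ∈ Λ₂ → x' ∈ Λ₁ → x' ∈ Λ₂ → y₁ ∈ Λ₁ → y₂ ∈ Λ₂ →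
      dist (meshPoint δ x) p < r → dist (meshPoint δ x') p < r →
      c ≤ dist (meshPoint δ y₁) p → c ≤ dist (meshPoint δ y₂) p →
      G₁.Reachable x y₁ → G₁.Reachable x' y₁ → G₂.Reachable x y₂ → G₂.Reachable x' y₂ →
      |τ G₁ Λ₁ x y₁ / τ G₁ Λ₁ x' y₁ / (τ G₂ Λ₂ x y₂ / τ G₂ Λ₂ x' y₂) - 1| < η

/-! ### Two lemmas on rounded sites -/

/-- The rounded site of a point at distance `≥ S + 2` from `p` is at distance `≥ S + 1` (`δ ≤ 1`). -/
theorem dist_meshPoint_nearestSite_ge {δ : ℝ} (hδ : 0 < δ) (hδ1 : δ ≤ 1) (p : ℂ) (S : ℝ) :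
    S + 1 ≤ dist (meshPoint δ (nearestSite δ (p + ((S + 2 : ℝ) : ℂ)))) p := by
  have h1 := dist_meshPoint_nearestSite_le hδ (p + ((S + 2 : ℝ) : ℂ))
  have h2 : dist (p + ((S + 2 : ℝ) : ℂ)) p = |S + 2| := by
    rw [Complex.dist_eq, add_sub_cancel_left, Complex.norm_real, Real.norm_eq_abs]
  have h3 := dist_triangle (p + ((S + 2 : ℝ) : ℂ)) (meshPoint δ (nearestSite δ (p + ((S + 2 : ℝ) : ℂ)))) p
  rw [dist_comm (p + ((S + 2 : ℝ) : ℂ)) (meshPoint δ _)] at h3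
  have h4 : S + 2 ≤ |S + 2| := le_abs_self _
  linarith

/-- … and at distance `≤ |S + 2| + 1`. -/
theorem dist_meshPoint_nearestSite_le' {δ : ℝ} (hδ : 0 < δ) (hδ1 : δ ≤ 1) (p : ℂ) (S : ℝ) :
    dist (meshPoint δ (nearestSite δ (p + ((S + 2 : ℝ) : ℂ)))) p ≤ |S + 2| + 1 := by
  have h1 := dist_meshPoint_nearestSite_le hδ (p + ((S + 2 : ℝ) : ℂ))
  have h2 : dist (p + ((S + 2 : ℝ) : ℂ)) p = |S + 2| := by
    rw [Complex.dist_eq, add_sub_cancel_left, Complex.norm_real, Real.norm_eq_abs]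
  have h3 := dist_triangle (meshPoint δ (nearestSite δ (p + ((S + 2 : ℝ) : ℂ)))) (p + ((S + 2 : ℝ) : ℂ)) p
  linarith

/-! ### The refutation -/

/-- **`ArmOriginForgettingAt` is false as defined**: for every Jordan domain `D` and every
`p ∈ closure D`, `¬ ArmOriginForgettingAt D.carrier p` (degenerate supergraph witness, see the
module docstring). -/
theorem not_armOriginForgettingAt (D : JordanDomain) {p : ℂ} (hp : p ∈ closure D.carrier) :
    ¬ ArmOriginForgettingAt D.carrier p := by
  intro H
  -- a point of `D` away from `p`
  obtain ⟨z₁, hz₁D, hz₁p⟩ : ∃ z₁ ∈ D.carrier, z₁ ≠ p := by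
    obtain ⟨z, hz⟩ := D.nonempty
    by_cases hzp : z = p
    · subst hzp
      obtain ⟨ρ, hρ, hball⟩ := Metric.isOpen_iff.1 D.isOpen z hz
      refine ⟨z + ((ρ / 2 : ℝ) : ℂ), hball ?_, ?_⟩
      · rw [Metric.mem_ball, Complex.dist_eq, add_sub_cancel_left, Complex.norm_real, Real.norm_eq_abs,
          abs_of_pos (half_pos hρ)]
        linarith
      · intro h
        have h2 : ((ρ / 2 : ℝ) : ℂ) = 0 := by
          have := congrArg (fun w => w - z) h
          simpa using this
        have h3 : (ρ / 2 : ℝ) = 0 := by exact_mod_cast h2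
        linarith
    · exact ⟨z, hz, hzp⟩
  set L := dist z₁ p with hL
  have hL0 : 0 < L := dist_pos.2 hz₁p
  obtain ⟨r, hr, hev⟩ := H (L / 2) 1 (1 / 2) (half_pos hL0) one_pos (by norm_num)
  -- a point of `D` within `r/2` of `p`
  obtain ⟨z₀, hz₀D, hz₀p⟩ : ∃ z₀ ∈ D.carrier, dist z₀ p < r / 2 := by
    obtain ⟨b, hb, hbd⟩ := Metric.mem_closure_iff.1 hp (r / 2) (half_pos hr)
    exact ⟨b, hb, by rwa [dist_comm]⟩
  -- compact neighbourhoods of `z₀, z₁` inside `D`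
  obtain ⟨ρ₀, hρ₀, hb₀⟩ := Metric.isOpen_iff.1 D.isOpen z₀ hz₀D
  obtain ⟨ρ₁, hρ₁, hb₁⟩ := Metric.isOpen_iff.1 D.isOpen z₁ hz₁D
  have hK : IsCompact (closedBall z₀ (ρ₀ / 2) ∪ closedBall z₁ (ρ₁ / 2)) :=
    (isCompact_closedBall _ _).union (isCompact_closedBall _ _)
  have hKD : closedBall z₀ (ρ₀ / 2) ∪ closedBall z₁ (ρ₁ / 2) ⊆ D.carrier :=
    union_subset ((closedBall_subset_ball (by linarith)).trans hb₀)
      ((closedBall_subset_ball (by linarith)).trans hb₁)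
  -- a bounding radius of `D` around `p`
  obtain ⟨R, hR⟩ := (Metric.isBounded_iff_subset_ball p).1 D.isBounded
  set R' := max R 1 with hR'
  have hR'1 : 1 ≤ R' := le_max_right _ _
  have hDR' : D.carrier ⊆ ball p R' := hR.trans (Metric.ball_subset_ball (le_max_left _ _))
  have hLR' : L < R' := by
    have := hDR' hz₁D
    rwa [Metric.mem_ball] at this
  -- one good mesh
  have hm : (0 : ℝ) < min (min (ρ₀ / 2) (ρ₁ / 2)) (min (r / 2) (min (L / 4) 1)) := by positivity
  obtain ⟨δ, ⟨hP, hJ⟩, hδ⟩ :=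
    ((hev.and (D.eventually_forall_mem_meshDomain' hK hKD)).and (Ioo_mem_nhdsGT hm)).exists
  have hδ0 : 0 < δ := hδ.1
  have hδρ₀ : δ ≤ ρ₀ / 2 := hδ.2.le.trans ((min_le_left _ _).trans (min_le_left _ _))
  have hδρ₁ : δ ≤ ρ₁ / 2 := hδ.2.le.trans ((min_le_left _ _).trans (min_le_right _ _))
  have hδr : δ < r / 2 := lt_of_lt_of_le hδ.2 ((min_le_right _ _).trans (min_le_left _ _))
  have hδL : δ < L / 4 :=
    lt_of_lt_of_le hδ.2 ((min_le_right _ _).trans ((min_le_right _ _).trans (min_le_left _ _)))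
  have hδ1 : δ ≤ 1 :=
    hδ.2.le.trans ((min_le_right _ _).trans ((min_le_right _ _).trans (min_le_right _ _)))
  -- the sites
  set x : Site 2 := nearestSite δ z₀ with hx
  set u₁ : Site 2 := nearestSite δ z₁ with hu₁
  set y₁ : Site 2 := nearestSite δ (p + ((R' + 2 : ℝ) : ℂ)) with hy₁
  set q : Site 2 := nearestSite δ (p + ((2 * R' + 4 + 2 : ℝ) : ℂ)) with hq
  have hxK : meshPoint δ x ∈ closedBall z₀ (ρ₀ / 2) ∪ closedBall z₁ (ρ₁ / 2) :=
    Or.inl (mem_closedBall.2 ((dist_meshPoint_nearestSite_le hδ0 z₀).trans hδρ₀))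
  have hu₁K : meshPoint δ u₁ ∈ closedBall z₀ (ρ₀ / 2) ∪ closedBall z₁ (ρ₁ / 2) :=
    Or.inr (mem_closedBall.2 ((dist_meshPoint_nearestSite_le hδ0 z₁).trans hδρ₁))
  have hx_mem : x ∈ meshDomain D.carrier δ := hJ.1 x hxK
  have hu₁_mem : u₁ ∈ meshDomain D.carrier δ := hJ.1 u₁ hu₁K
  -- distances
  have hxr : dist (meshPoint δ x) p < r := by
    have := dist_triangle (meshPoint δ x) z₀ p
    have h2 := dist_meshPoint_nearestSite_le hδ0 z₀
    linarith
  have hu₁far : L - δ ≤ dist (meshPoint δ u₁) p := by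
    have := dist_triangle z₁ (meshPoint δ u₁) p
    have h2 := dist_meshPoint_nearestSite_le hδ0 z₁
    rw [dist_comm z₁ (meshPoint δ u₁)] at this
    linarith
  have hu₁D : meshPoint δ u₁ ∈ D.carrier := hKD hu₁K
  have hu₁R : dist (meshPoint δ u₁) p < R' := by
    have := hDR' hu₁D
    rwa [Metric.mem_ball] at this
  have hxR : dist (meshPoint δ x) p < R' := by
    have := hDR' (hKD hxK)
    rwa [Metric.mem_ball] at this
  have hy₁far : R' + 1 ≤ dist (meshPoint δ y₁) p := dist_meshPoint_nearestSite_ge hδ0 hδ1 p R'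
  have hy₁near : dist (meshPoint δ y₁) p ≤ |R' + 2| + 1 := dist_meshPoint_nearestSite_le' hδ0 hδ1 p R'
  have hqfar : 2 * R' + 4 + 1 ≤ dist (meshPoint δ q) p :=
    dist_meshPoint_nearestSite_ge hδ0 hδ1 p (2 * R' + 4)
  have habs : |R' + 2| = R' + 2 := abs_of_pos (by linarith)
  rw [habs] at hy₁near
  -- non-memberships and distinctness
  have hy₁_notmem : y₁ ∉ meshDomain D.carrier δ := by
    intro h
    have h1 : meshPoint δ y₁ ∈ D.carrier := (mem_meshVertices_iff).1 (meshDomain_subset_meshVertices _ _ h)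
    have h2 := hDR' h1
    rw [Metric.mem_ball] at h2
    linarith
  have hq_notmem : q ∉ meshDomain D.carrier δ := by
    intro h
    have h1 : meshPoint δ q ∈ D.carrier := (mem_meshVertices_iff).1 (meshDomain_subset_meshVertices _ _ h)
    have h2 := hDR' h1
    rw [Metric.mem_ball] at h2
    linarith
  have hy₁q : y₁ ≠ q := by
    intro h
    have : dist (meshPoint δ y₁) p = dist (meshPoint δ q) p := by rw [h]
    linarith
  have hy₁u : y₁ ≠ u₁ := fun h => hy₁_notmem (h ▸ hu₁_mem)
  have hqu : q ≠ u₁ := fun h => hq_notmem (h ▸ hu₁_mem)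
  have hxy : x ≠ y₁ := fun h => hy₁_notmem (h ▸ hx_mem)
  -- the supergraph: `Ω_δ` plus the two edges `u₁ q`, `q y₁`
  set Ωδ := discreteDomainGraph D.carrier δ with hΩδ
  set E : Set (Sym2 (Site 2)) := Ωδ.edgeSet ∪ {s(u₁, q), s(q, y₁)} with hE
  set G₁ : SimpleGraph (Site 2) := SimpleGraph.fromEdgeSet E with hG₁
  have hadj : ∀ v w : Site 2,
      G₁.Adj v w ↔ (Ωδ.Adj v w ∨ s(v, w) = s(u₁, q) ∨ s(v, w) = s(q, y₁)) ∧ v ≠ w := by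
    intro v w
    rw [hG₁, SimpleGraph.fromEdgeSet_adj, hE]
    simp only [Set.mem_union, SimpleGraph.mem_edgeSet, Set.mem_insert_iff, Set.mem_singleton_iff]
  haveI hLF : G₁.LocallyFinite := by
    intro v
    apply Set.Finite.fintype
    refine Set.Finite.subset ((Ωδ.neighborSet v).toFinite.union (Set.toFinite {u₁, q, y₁})) ?_
    intro w hw
    rw [SimpleGraph.mem_neighborSet, hadj] at hw
    rcases hw.1 with h | h | h
    · exact Or.inl h
    · right
      rw [Sym2.eq_iff] at h
      rcases h with ⟨-, rfl⟩ | ⟨-, rfl⟩ <;> simp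
    · right
      rw [Sym2.eq_iff] at h
      rcases h with ⟨-, rfl⟩ | ⟨-, rfl⟩ <;> simp
  have hle : Ωδ ≤ G₁ := fun v w h => (hadj v w).2 ⟨Or.inl h, h.ne⟩
  -- the finite volume
  set Λ₁ : Finset (Site 2) := insert y₁ (meshDomainFinset D.carrier δ) with hΛ₁
  have hΛmem : ∀ v, v ∈ Λ₁ ↔ v = y₁ ∨ v ∈ meshDomain D.carrier δ := by
    intro v
    rw [hΛ₁, Finset.mem_insert, ← Finset.mem_coe, coe_meshDomainFinset D.isBounded hδ0]
  have hy₁Λ : y₁ ∈ Λ₁ := (hΛmem y₁).2 (Or.inl rfl)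
  have hxΛ : x ∈ Λ₁ := (hΛmem x).2 (Or.inr hx_mem)
  -- local agreement
  have hLA : LocalAgreement D.carrier p (L / 2) δ G₁ Λ₁ := by
    intro w _ hball v
    rw [Metric.mem_ball] at hball
    have hwu : w ≠ u₁ := by
      rintro rfl
      linarith
    have hwq : w ≠ q := by
      rintro rfl
      linarith
    have hwy : w ≠ y₁ := by
      rintro rfl
      linarith
    refine ⟨?_, ?_⟩
    · rw [hadj]
      constructor
      · rintro ⟨h | h | h, _⟩
        · exact h
        · exfalso
          rw [Sym2.eq_iff] at h
          rcases h with ⟨h1, -⟩ | ⟨h1, -⟩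
          exacts [hwu h1, hwq h1]
        · exfalso
          rw [Sym2.eq_iff] at h
          rcases h with ⟨h1, -⟩ | ⟨h1, -⟩
          exacts [hwq h1, hwy h1]
      · intro h
        exact ⟨Or.inl h, h.ne⟩
    · intro h
      exact (hΛmem v).2 (Or.inr (discreteDomainGraph_adj_iff.1 h).2.2)
  -- reachability `x ⇝ u₁ → q → y₁` in `G₁`
  have hreach : G₁.Reachable x y₁ := by
    obtain ⟨hxv, huv, hru⟩ := hJ.2 x hx_mem u₁ hu₁_mem
    obtain ⟨w⟩ := hru
    have h1 : Ωδ.Reachable x u₁ := reachable_discreteDomainGraph_of_walk w hx_mem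
    have h2 : G₁.Adj u₁ q := (hadj u₁ q).2 ⟨Or.inr (Or.inl rfl), hqu.symm⟩
    have h3 : G₁.Adj q y₁ := (hadj q y₁).2 ⟨Or.inr (Or.inr rfl), hy₁q.symm⟩
    exact ((h1.mono hle).trans h2.reachable).trans h3.reachable
  -- the far spin is isolated in the interaction graph of `Λ₁`: `τ = 0`
  have hτ : τ G₁ Λ₁ x y₁ = 0 := by
    unfold τ
    rw [isingTwoPoint_free_eq_hteSum_div _ _ _ hxΛ hy₁Λ]
    have hnum : hteSum G₁ Λ₁ (Real.tanh criticalBetaTwo) ({x} ∆ {y₁}) = 0 := by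
      unfold hteSum
      apply Finset.sum_eq_zero
      intro F hF
      exfalso
      rw [Finset.mem_filter, Finset.mem_powerset] at hF
      obtain ⟨hFsub, hodd⟩ := hF
      have hy : y₁ ∈ oddVerts Λ₁ F := by
        rw [hodd, Finset.mem_symmDiff]
        right
        exact ⟨Finset.mem_singleton_self _, fun h => hxy (Finset.mem_singleton.1 h).symm⟩
      rw [oddVerts, Finset.mem_filter] at hy
      have hempty : F.filter (fun e => y₁ ∈ e) = ∅ := by
        rw [Finset.filter_eq_empty_iff]
        intro e he hye
        have he' := hFsub he
        rw [mem_edgesIn_iff] at he'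
        obtain ⟨heG, heΛ⟩ := he'
        obtain ⟨v, rfl⟩ := Sym2.mem_iff_exists.1 hye
        rw [SimpleGraph.mem_edgeSet, hadj] at heG
        obtain ⟨h | h | h, _⟩ := heG
        · exact hy₁_notmem (discreteDomainGraph_adj_iff.1 h).2.1
        · rw [Sym2.eq_iff] at h
          rcases h with ⟨h1, -⟩ | ⟨h1, -⟩
          exacts [hy₁u h1, hy₁q h1]
        · rw [Sym2.eq_iff] at h
          rcases h with ⟨h1, -⟩ | ⟨-, h2⟩
          · exact hy₁q h1
          · have hqΛ : q ∈ Λ₁ := heΛ q (by rw [h2]; exact Sym2.mem_mk_right _ _)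
            rcases (hΛmem q).1 hqΛ with h3 | h3
            · exact hy₁q h3.symm
            · exact hq_notmem h3
      rw [hempty, Finset.card_empty] at hy
      exact absurd hy.2 (by decide)
    rw [hnum, zero_div]
  -- the conclusion of `ArmOriginForgettingAt` at this datum is `|0 - 1| < 1/2`
  have hc : (1 : ℝ) ≤ dist (meshPoint δ y₁) p := by linarith
  have key := hP G₁ G₁ Λ₁ Λ₁ x x y₁ y₁ hLA hLA hxΛ hxΛ hxΛ hxΛ hy₁Λ hy₁Λ hxr hxr hc hc
    hreach hreach hreach hreach
  rw [hτ] at key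
  norm_num at key

/-- In particular at the marked prime end `a = D.pt 0` of every Dobrushin domain (the datum of
`stub_armOriginForgettingCore`): `¬ ArmOriginForgettingAt D.carrier (D.pt 0)`. -/
theorem not_armOriginForgettingAt_pt (D : DobrushinDomain) (i : Fin 2) :
    ¬ ArmOriginForgettingAt D.carrier (D.pt i) :=
  not_armOriginForgettingAt D.toJordanDomain (frontier_subset_closure (D.pt_mem_frontier i))

/-- Hence the rev-4 statement `∀ D, ArmOriginForgettingAt D.carrier (D.pt 0)` (the conclusion of
`stub_armOriginForgettingCore`) is false, and `ArmOriginForgetting` (the hypothesis of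
`stub_localAgreementTransfer`) is false: that stub is vacuous. -/
theorem not_forall_armOriginForgettingAt :
    ¬ ∀ (D : DobrushinDomain), ArmOriginForgettingAt D.carrier (D.pt 0) := fun h =>
  not_armOriginForgettingAt_pt DobrushinDomain.unitDisc 0 (h _)

end Summit.CriticalPhenomena.SAWScalingLimit.Cruxes.IsingBoundaryRatio.FkAnchorTransferC1

end
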